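import Mathlib
import HarnessLib
import HarnessLib.Audit
import Summits.RiemannHypothesis.Statement
import HarnessLib.Audit.Status.Attr

/-!
Route: Fences

DORMANT since 2026-08-26T13:40:03Z (reconciler: no traction for 6.7 d (last activity item-proof-filed at 2026-08-19T20:26:07Z); parked, not closed — `ledger route dormant route-RiemannHypothesis-Fences --off` to reactivate) — unstaffed, not closed; items shared with open routes are served there. `ledger route dormant <id> --off` reactivates.

# Route Fences — If RH fails robustly it fails in clusters — exclusion by short prime sums modulo a
budgeted two-sided power-sum theorem

Rev 4 (route-choice after the substantive refutation of InverseTuranLattice, 2026-08-16). The FENCE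
line (X1 FenceDichotomy = DETECTED ∨ FENCED, X2 NoFences) is retired: chirped theta bows (refuter
rattack-2994 on stmt-RiemannHypothesis-2994: Jacobi's imaginary transformation, uniform in the
weight W and the scale A; sup|F| ≤ (2N)^{-C(X)}, C(X) = X/(2 ln(4X+2)) − 1) are B^{-C}-invisible
two-sided configurations through 0 lying on no near-lattice, and no inverse theorem for
super-polynomially small short-interval power sums can constrain more than the first O(C log B)
neighbours of the distinguished term (barrier candidate ThetaBowInvisibility). What survives of
Maynard–Pratt inversion is FIRST-NEIGHBOUR information, and the route is re-drawn on it.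
Positive-side reading as before (MaynardPratt2024 = arXiv:2206.11729: Prop. 16 p. 10, Lemma 11 p. 8,
§8 p. 20; Prop. 16 and Lemma 11 are PROVED in tree, MaynardPratt2024_prop16_holds /
MaynardPratt2024_lemma11_holds): at a zero ρ₀ the short smoothed prime sum S_U(ρ₀) = Σ Λ(n) w(n/U)
n^{-ρ₀}, t = log U ∈ [A,2A], A = log T/loglog T, is the power sum −Σ_ρ m_ρ W(ρ−ρ₀) e^{t(ρ−ρ₀)} over
the local zero configuration, with its own term −W(0). NEW CUT. (X0, abstract) a power sum with
distinguished term (0,1), coefficients near-positive within K log B/A of 0 and BUDGET Σ|c_r| max(1,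
e^{2A Re z_r}) ≤ B that is ≤ B^{-C} on all of [A,2A] has nodes strictly above AND strictly below 0
within Im-distance K log B/A at depth ≥ −K log B/A (TwoSidedPowerSum). (X1, ζ-side) if short prime
sums have square-root cancellation right of 1/2+η at height T — smallness e^{−A(Re ρ₀ − 1/2)},
EXPONENTIAL in A, not (log T)^{-C} — then X0 applies at every near-apex zero ρ₀ right of 1/2+2η and
again at the flanking zero it produces, up an ordinate-increasing chain whose budget giants e^{2A
d_j} let the flank tolerance grow only geometrically: ≥ c·loglog T distinct zeros right of 1/2+η
within vertical distance 1 of ρ₀ (ClusterForcing). It suffices to show X = X1 ∧ X2 ∧ X3 ∧ X4: X1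
ClusterForcing; X2 SubLoglogClustering (ζ has at most o(loglog T) zeros right of 1/2+η in every unit
window at height T — Backlund's zero condition, EQUIVALENT to the Lindelöf hypothesis (Titchmarsh
Thm 13.5; tree Literature.Barriers.RiemannHypothesis.Titchmarsh1986_thm13_5 /
BacklundZeroCondition), with log log T in place of log T; RH-implied); X3 ShortPrimeSumCancellation
(kept: square-root cancellation of S_U right of 1/2+η for U ∈ [T^{1/loglog T}, T^{2/loglog T}],
RH-implied); X4 LevelwiseZeroOrInfinity (kept: at every abscissa σ₀ > 1/2 the zeros to its right are
none or infinitely many). X1–X3 leave finitely many zeros right of each σ₀ > 1/2 (support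
FiniteExceptionsFromClusters: a penalised-argmax choice of a near-apex zero, X1's cluster against
X2's count), X4 empties every level, hence RH by the functional equation exactly as at rev 2.
Lean: `ClusterForcing → SubLoglogClustering → ShortPrimeSumCancellation → LevelwiseZeroOrInfinity →
Summit.RiemannHypothesis`

## Assembly
DECIDING THEOREM (rev 4, proved in-file, axioms propext/Classical.choice/Quot.sound): `closes :
ClusterForcing → SubLoglogClustering → ShortPrimeSumCancellation → LevelwiseZeroOrInfinity →
FiniteExceptionsFromClusters → Summit.RiemannHypothesis` — the rev-2 proof with the three fence
hypotheses replaced: FiniteExceptionsFromClusters turns X1–X3 into 'finitely many zeros with σ₀ ≤ Re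
s < 1 for every σ₀ > 1/2', X4 at level σ₀ = Re s empties it, no zero has Re s ≥ 1 (Mathlib
riemannZeta_ne_zero_of_one_le_re), and a non-trivial zero with Re s < 1/2 is reflected by
riemannZeta_one_sub to t = 1 − s, Re t > 1/2, where ζ(t) = 0 is excluded, so cos(πt/2) = 0 and s =
−2k is 0 (but ζ(0) = −1/2) or a trivial zero. Item Assembly, RESTATED at rev 4 as X1 → X2 → X3 → X4
→ RH, follows from `closes` once FiniteExceptionsFromClusters is proved. DROPPED at rev 4:
FenceDichotomy, NoFences, FiniteExceptions (the fence chain — FenceDichotomy and NoFences are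
RH-vacuous hence unrefuted, but their only mechanism, InverseTuranLattice, is refuted and the fence
cut cannot be the output of any inverse theorem); InverseTuranLattice (REFUTED-SUBSTANTIVE, informal
item stmt-RiemannHypothesis-2994, evidence EVIDENCE.md / chirpbow_decimal.py /
InverseTuranScratch.lean kept there as negative knowledge); MaynardPrattDetection (Prop. 16 is
vendored AND proved in tree as MaynardPratt2024_prop16_holds with corollary .detection; as typed the
item's Y-range log Y ≤ log T exceeded the printed proof, grounder g15-15).

Rationale: WHY THIS LINE. Maynard–Pratt (MaynardPratt2024: Thm 4 / Prop. 16 / Lemma 11 / §8; Prop. 16 and Lemma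
11 PROVED in tree) detect a zero by a short prime sum S_U, U = T^{o(1)}, whenever its local
configuration is one-sided ('half-isolated'), and they COUNT such zeros (density). This route
EXCLUDES: if S_U is never abnormally large right of 1/2+η (X3), every off-line zero there is
undetected in the strong sense |S_U(ρ)| ≤ U^{1/2−Re ρ}(log T)^3, and a budgeted two-sided inverse
theorem (X0) turns that smallness into local structure. Rev 2 asked X0 for a FENCE (fully occupied
near-lattice through ρ₀) and was refuted: super-polynomial smallness on [A,2A] is produced by ANY
smooth two-sided node density (Poisson / Jacobi: chirped combs, theta bows; refuters 2befef16,
rattack-2994), so inverse theory can see only the first neighbours of 0, at resolution K log B/A.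
Rev 4 takes exactly that: X0 = first neighbours on both sides; iterated from a near-apex zero along
an ordinate-increasing chain it forces ≥ c loglog T off-line zeros in a unit window (X1
ClusterForcing), and the complement X2 becomes a COUNT statement — Backlund's o(log T) per unit
window (⟺ Lindelöf, Titchmarsh1986 Thm 13.5) sharpened to o(loglog T) — instead of an AP-exclusion
statement. Imports: budgeted Turán–Nazarov / F.-and-M.-Riesz harmonic analysis (Montgomery1994 ch.
5; Nazarov's complete Turán lemma zbl:0991.42001; M-P Lemma 11) and the time–frequency cost of
superoscillation (Kempf–Ferreira, doi:10.1088/0305-4470/37/50/009) for X0; the smoothed explicit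
formula with multiplicities (tree SmoothedExplicitFormula*, HalfIsolatedZeroProofs) for X1; nothing
for X2–X4, declared no-tool. What no prior route does: Strip parks RH in 'a zero-free strip by any
means'; here emptiness right of 1/2 is split into a prime-sum statement (X3), a zero-COUNT statement
strictly between Lindelöf and quasi-RH (X2), a typed finite-dimensional inverse theorem (X0) with
its ζ-side corollary (X1), and a rigidity statement (X4); X0 and X1 are workable now and the
Lindelöf-for-primes equivalence of Gonek–Graham–Lee (doi:10.1090/proc/14974) marks why X3 with LONG
sums would be RH itself while the short range U = T^{1/loglog T} is what detection consumes.
Declared plainly: X2, X3, X4 are RH-implied statements with no known tool; the route is a map of how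
RH could fail robustly — in clusters of ≥ loglog T off-line zeros per unit window, invisible to
every short prime sum — with two cruxes that can close.

RANKED CRUXES. #2 TwoSidedPowerSum (crux) — [abstract; the surviving content of M-P §8 inversion
after the theta-bow refutation; refuter rattack-2994's TwoSidedNeighbours made precise with a
budget] there are C, K > 0 and B₀ such that for every finite configuration (z_r, c_r) with a
distinguished term (0, 1), budget Σ_r |c_r| max(1, e^{2A Re z_r}) ≤ B (B ≥ B₀, A > 0),
near-positivity |arg c_r| ≤ 1/10 whenever |z_r| ≤ K log B/A, and sup_{t∈[A,2A]} |Σ c_r e^{t z_r}| ≤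
B^{-C}: some node has 0 < Im z_r ≤ K log B/A and Re z_r ≥ −K log B/A, and some node has −K log B/A ≤
Im z_r < 0 and Re z_r ≥ −K log B/A. The one-sided case is Lemma 11 (proved in tree, exponent 99);
right-lying nodes are allowed and pay e^{2A Re z} in the budget (refuter 3ebf6cbd's point: zeros
right of ρ₀ enter S_U(ρ₀) amplified); the flank scale is K log B/A and not K/A because Gaussian
combs of width √(C log B)/A at spacing < π/A are already B^{-C}-invisible (Poisson). [difficulty:
XL] (why it might fail: a budget-B configuration might cancel the distinguished term across a
one-sided gap of K log B/A — budgeted superoscillation by far or right-lying signed nodes; Lemma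
11's Jensen-at-iA proof has no two-sided analogue, off the axis far nodes are amplified.)
[MaynardPratt2024, Montgomery1994, zbl:0991.42001, doi:10.1088/0305-4470/37/50/009]
#3 ClusterForcing (crux) — [ζ-side; Maynard–Pratt detection run in exclusion mode] there are c > 0
and an admissible bump w (C^∞, ≥ 0, supp ⊆ [1/2,2], w(1) = 1) such that for every η > 0 and T ≥
T₀(η): IF |Σ Λ(n) w(n/U) n^{-s}| ≤ U^{1/2−Re s}(log T)^3 for all s with 1/2+η ≤ Re s ≤ 1, Im s ∈
[T,2T] and all U with log U ∈ [log T/loglog T, 2 log T/loglog T] (the conclusion of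
ShortPrimeSumCancellation at (w, η, T), verbatim), THEN every zero ρ₀ with Re ρ₀ ≥ 1/2+2η and Im ρ₀
∈ [T+1, 2T−1] that is near-apex (every zero within (log T)² vertically has real part ≤ Re ρ₀ +
(loglog T)²/log T) has ≥ c·loglog T distinct zeros with Re ≥ 1/2+η within vertical distance 1 of it.
Intended proof: explicit formula at ρ_j over ALL zeros of the (log T)²-window (truncation only at
size T^{-0.6}, which needs w₀-type Mellin decay e^{−√(y/2)}: M-P Lemma 43), budget B_j ≤ (log T)^5
e^{2A d_j} (d_j = Re ρ₀ − Re ρ_j), X0 at each step, recursion d_{j+1} ≤ (1+2KC) d_j + 5K loglog T/A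
up to a depth cap D(η, K, C) ⇒ k ≥ loglog T/(2 log(1+2KC)) ordinate-increasing steps inside a
vertical window < 1/4. [deps: TwoSidedPowerSum] [difficulty: XL] (why it might fail: needs X0
exactly as typed — positivity zone AND flank box K log B/A; a (log B)²/A zone as in Lemma 11 reaches
absolute size ≫ 1 once budgets carry e^{2A d_j}; window, slack and T-uniformity must survive the
explicit-formula bookkeeping with multiplicities.) [MaynardPratt2024, arXiv:2206.11729,
Titchmarsh1986]
#4 SubLoglogClustering (crux) — [new; replaces NoFences] for every η > 0 and b > 0, T ≥ T₀(η, b) and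
t ∈ [T,2T]: at most b·loglog T distinct zeros of ζ have Re ≥ 1/2+η and |Im − t| ≤ 1. Unconditionally
the count is O(log T) (Titchmarsh1986 Thm 9.2); 'o(log T) for every η' is EQUIVALENT to the Lindelöf
hypothesis (Backlund 1918–19; Titchmarsh1986 Thm 13.5 = tree Titchmarsh1986_thm13_5 with
BacklundZeroCondition; generalised by Garunkštis, zbl:1228.11134); RH gives 0. So RH ⇒ X2 ⇒ LH: a
zero-COUNT statement strictly between Lindelöf and quasi-RH. [difficulty: open-problem] (why it
might fail: RH-vacuous and at least Lindelöf-hard; no tool bounds off-line zeros in a unit window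
below O(log T) — Jensen needs log|ζ| ≥ −o(log T) at a nearby point; it fails for
Davenport–Heilbronn-type Dirichlet series, whose off-line zeros have positive density.)
[Titchmarsh1986, zbl:1228.11134, doi:10.1090/proc/14974]
#4 ShortPrimeSumCancellation (crux, kept from rev 2) — for every admissible bump w, every η > 0 and
T ≥ T₀(w, η): |Σ Λ(n) w(n/U) n^{-s}| ≤ U^{1/2−Re s}(log T)^3 for 1/2+η ≤ Re s ≤ 1, Im s ∈ [T,2T],
log U ∈ [log T/loglog T, 2 log T/loglog T]. RH-implied (explicit formula); it feeds X1's hypothesis.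
(why it might fail: RH-strength square-root cancellation at U = T^{1/loglog T}; Vinogradov–Korobov
short by (loglog T)² in the exponent; with LONG sums it would be RH by Landau/Turán resp.
Gonek–Graham–Lee.) [Ivic1985, MontgomeryVaughan2007, MaynardPratt2024, doi:10.1090/proc/14974]
#5 LevelwiseZeroOrInfinity (crux, kept from rev 2) — for every 1/2 < σ₀ < 1: finitely many zeros
with σ₀ ≤ Re s < 1 ⇒ none. (why it might fail: needs ℤ-specific input; false for Beurling zetas with
one off-line zero, BrouckeDebruyneRevesz2023; Bagchi recurrence is RH-equivalent.)
[BrouckeDebruyneRevesz2023, DiamondMontgomeryVorhauer2006, Bagchi1987, Titchmarsh1986]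
#9 FiniteExceptionsFromClusters (support) — [glue] ClusterForcing → SubLoglogClustering →
ShortPrimeSumCancellation → for every σ₀ > 1/2 the zeros with σ₀ ≤ Re s < 1 form a finite set. Proof
(provable now): η := (σ₀ − 1/2)/2; take c, w from X1; T₀ := the max of X3's threshold at (w, η),
X1's at η, X2's at (η, c/2) and an absolute constant; given a zero ρ with Re ρ ≥ σ₀ at height h ≥
1.5 T₀ put T := 2h/3, κ := (loglog T)²/(log T)³ and let ρ₀ maximise Re ρ' − κ|Im ρ' − h| over the
finite set of zeros with Re ρ' ≥ σ₀, |Im ρ' − h| ≤ T/4 (zetaZeroBox_finite): then |Im ρ₀ − h| ≤ (log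
T)³/(2(loglog T)²), so Im ρ₀ ∈ [T+1, 2T−1], Re ρ₀ ≥ 1/2+2η, and every zero within (log T)²
vertically has Re ≤ Re ρ₀ + κ(log T)² = Re ρ₀ + (loglog T)²/log T (near-apex); X3 supplies X1's
hypothesis, X1 gives ≥ c loglog T zeros in ρ₀'s unit window right of 1/2+η, X2 at t = Im ρ₀ allows ≤
(c/2) loglog T: contradiction. Negative ordinates by riemannZeta_conj_eq_zero; the remaining zeros
lie in a compact box. [difficulty: M]
#9 PowerSumExponentOne (support, kept) — the sharp-exponent calibration κ* ∈ [0.558, 99] for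
unit-coefficient sums (Bourgain's q²−q design vs Lemma 7); it now informs the constants C, K of X0.
#1 Assembly (assembly, restated at rev 4) — ClusterForcing → SubLoglogClustering →
ShortPrimeSumCancellation → LevelwiseZeroOrInfinity → RH.

TWO-LAYER PLAN. Foreseen split of ClusterForcing once X0 closes: ClusterForcing ⇐
LocalPowerSumAtZero (explicit formula at a zero ρ_j right of 1/2+η over all zeros of the (log
T)²-window, error T^{-0.6}, in X0's budget currency) → ChainRecursion (d_{j+1} ≤ (1+2KC)d_j + 5K
loglog T/A ⇒ ≥ c loglog T steps inside a window of length 1/4) → ClusterForcing. Foreseen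
strengthening, filed only if X0 closes fast: TwoSidedPowerSumStrong — the visible zone |Im z| ≤ K
log B/A is two-sided gap-free at scale K'/A — which replaces the chain by one application and
weakens X2 to 'o(loglog T) off-line zeros per window of length (loglog T)²/log T'. No split of X2–X4
(no tool).

KILL CRITERIA. Close refuted:TwoSidedPowerSum if for every (C, K) a budget-B two-sided configuration
with sup_{[A,2A]}|F| ≤ B^{-C} and a ONE-SIDED GAP (no node with 0 < Im z ≤ K log B/A, Re z ≥ −K log
B/A) is exhibited — then Maynard–Pratt detection cannot be inverted even locally and the line has no
mechanism; this is the LAST restatement of the escape clause (no rev 4). Close exhausted if X0 is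
provable only with a flank scale growing faster than log B (e.g. (log B)²/A): ClusterForcing's
recursion then yields O(1) zeros and X2 would have to become 'no flat-topped off-line triple', which
is not filed. X2–X4 cannot be refuted short of ¬RH; the route lives or dies by X0/X1 and starves
honestly otherwise. A proof elsewhere of ∀σ₀>1/2 QuasiRH σ₀ (route Strip) moots everything.

NOT DECOMPOSED YET. No explicit-formula lemmas (the tree's prime side and the Prop. 16 proof are to
be mined), no choice of w beyond admissibility + w(1) = 1 (w₀ of Lemma 43 is the intended witness;
Gevrey bumps with zero-free Mellin transform, refuter 3ebf6cbd, are an option), no constants (C, K,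
B₀; c = 1/(2 log(1+2KC))), no multiplicity bookkeeping, no Davenport–Heilbronn census (card I3 stays
a lab), no uniform-in-η (tube) versions — level-wise by design, the tube is X4's job.

CHEAPEST FALSIFIER. (1) For TwoSidedPowerSum, kit search at A ∈ {6, …, 16}: minimise sup_{[A,2A]} |1
+ Σ c_r e^{t z_r}| over configurations with an imposed EMPTY box (0 < Im z ≤ g, Re z ≥ −g), free
nodes elsewhere (both signs of Im; Re z > 0 charged e^{2A Re z} in the budget), near-positive
coefficients inside |z| ≤ g; plot achievable smallness against gA/log B — X0 predicts a floor
B^{−O(gA/log B)}, and smallness B^{-C} with gA/log B bounded as B grows kills it. Seeds: theta bows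
with the nodes above the apex deleted plus a compensating far comb (refuter's chirpbow_decimal.py),
Bourgain products. (2) For ClusterForcing: redo the budget recursion on paper against the constants
of any proposed proof of X0; a positivity zone (log B)²/A kills the chain at step 2. (3) Lookup:
citations of MaynardPratt2024 for a two-sided Lemma 11 (lit citing 2026-08-15: Guth's survey
arXiv:2503.07410 only; zbMATH 2026-08-16: Turnage-Butterbaugh's survey arXiv:2607.04632; nothing
two-sided).

NUMBERS. A = log T/loglog T; along the chain B_j ≍ (log T)^5 e^{2A d_j}, flank/positivity scale K
log B_j/A = K(5 loglog T + 2A d_j)/A; depth cap D = min(η₀/(1+2C), η, 1/(14K), 1/4) (1/(14K) keeps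
|Im z| ≤ 1/7, where |arg W₀(z)| ≤ (log 2)|Im z| < 1/10 for the Mellin transform of any bump on
[1/2,2]); chain length ⌊log(2AD/(5K loglog T) + 1)/log(1+2KC)⌋ ≥ loglog T/(2 log(1+2KC)) for T ≥
T₀(η); window (log T)², slack (loglog T)²/log T (2A·slack = 2 loglog T), truncation error U^{1/2}
e^{−log T/√2} (log T)^{O(1)} ≤ T^{-0.6}; Lemma 11 exponent 99, Bourgain exponent 0.558; the refuted
lattice line: theta bow X = 100: sup 1.5e-23 ≤ (2N)^{-C(X)} = 7.8e-20, X = 250: 1.7e-59 (refuter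
rattack-2994); trivially N(σ,T+1) − N(σ,T) ≪ log T, on LH o(log T), on RH 0.

Novelty: Searches (2026-08-16, this revision; searchd/OpenAlex/S2 unavailable or rate-limited today, zbMATH
and galaxy up): zbMATH 'Turán lemma Nazarov' (Nazarov's complete Turán lemma zbl:0991.42001 —
local-vs-global sup of exponential polynomials with loss e^{A(n−1)μ}, exponential in the number of
terms, no structure conclusion), 'superoscillation' (Kempf–Ferreira doi:10.1088/0305-4470/37/50/009
and sequels: superoscillation costs exponentially large norm — the heuristic behind the flank scale
K log B/A; not a theorem about power sums), 'Lindelöf hypothesis equivalent zeros' (Garunkštis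
zbl:1228.11134 generalising Backlund; Gonek–Graham–Lee doi:10.1090/proc/14974: Lindelöf for PRIME
sums ⟺ RH, long sums), 'zeros zeta function short intervals density hypothesis' (MaynardPratt2024
review; Turnage-Butterbaugh survey arXiv:2607.04632, 2026), 'Karatsuba conjecture Lindelöf' (Feng
2004 doi:10.4064/aa114-3-4, critical-line zeros in short intervals — different object); galaxy
--star all 'half-isolated zeros' / 'power sum small on an interval positive coefficients' (0 rows);
tree: Literature.Barriers.RiemannHypothesis.LindelofBacklund (Titchmarsh1986 Thm 13.5 vendored, RH ⇒
Backlund PROVED), MaynardPrattPowerSum(Proofs) and HalfIsolatedZero(Proofs) (Lemma 11, Prop. 16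
PROVED); ledger negatives RiemannHypothesis (0 typed; the informal InverseTuranLattice refutation is
on stmt-RiemannHypothesis-2994); rev-2 searches (2026-08-15) stand: lit search --hybrid 'Turan power
sum criterion quasi Riema  [refs: 10.1088/0305-4470/37/50/009, 10.1090/proc/14974:, 10.4064/aa114-3-4, 10.1093/imrn/rnae191, 2607.04632, 2206.11729, 2503.07410, doi:10.1088/0305-4470/37/50/009, doi:10.1090/proc/14974, doi:10.4064/aa114-3-4, doi:10.1093/imrn/rnae191, MaynardPratt2024, Titchmarsh1986, Montgomery1994]

Barriers (technique_class: short-prime-sum-detection, inverse-Turan, zero-count): - technique_class: short-prime-sum-detection, inverse-Turan, zero-count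
- Literature.Barriers.RiemannHypothesis.LindelofBacklund: met head-on — X2 (SubLoglogClustering) is
a zero-COUNT statement and by Titchmarsh1986 Thm 13.5 it yields exactly Lindelöf and density, never
emptiness; the route does not claim otherwise: emptiness comes only from X2 TOGETHER with the
prime-side X3 and the inverse theorem X0/X1 (clusters forced vs clusters forbidden). Nothing on the
chain is a moment or size bound for ζ.
- Literature.Barriers.RiemannHypothesis.DavenportHeilbronn: evaded in kind by X1/X3 — S_U is a PRIME
sum and the explicit formula used is −ζ'/ζ = Σ Λ(n) n^{-s} (Euler product); the Davenport–Heilbronn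
function has zeros in σ > 1 and no Λ-series, so X1 and X3 have no DH analogue. X2 and X4 are
FE-generic in form, false for DH-type functions, and the route claims no FE-only proof of them
(declared no-tool).
- Literature.Barriers.RiemannHypothesis.MollifierLimitations: not in class — no mollifier ζ·M
appears; the detector is the prime polynomial S_U itself. Listed to prevent conflation of 'short
zero-detecting polynomial' with Levinson–Conrey mollification.
- Literature.Barriers.RiemannHypothesis.BohrDenseValues: applies to X4 if attacked through
universality / self-recurrence (Bagchi: RH-equivalent) — declared no-tool for that reason; X0–X3 do
not use value-distribution.
- Literature.Barriers.RiemannHypothesis.TuranPartialSums: different Turán (zeros of partial sums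
Σ_{n≤N} n^{-s})

History (route lifecycle, newest last):
- 2026-08-15T16:16:06Z · rev 2: dropped StripFromFiniteExceptions — route-repair (rbadge g2): deciding theorem closes : FenceDichotomy → NoFences → ShortPrimeSumCancellation → LevelwiseZeroOrInfinity → FiniteExceptions → Summit. (planner-rbadge-RiemannHypothesis-Fences-007bbc9e-g2-0)
- 2026-08-16T02:17:41Z · AUTO-CRUX: 1 conjecture-grade item(s) promoted to crux (InverseTuranLattice) — refuter vetting / tiering apply (operator:999:1362873)
- 2026-08-16T03:26:19Z · rev 3: dropped stmt-RiemannHypothesis-2994, stmt-RiemannHypothesis-2868 — route-choice step 1/2 after refuted-substantive stmt-RiemannHypothesis-2994: drop InverseTuranLattice (REFUTED by chirped theta bows, refuter-rattack-2994; info (planner-rchoice-RiemannHypothesis-Fences-stmt--8f57a55c-0)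
- 2026-08-16T03:31:08Z · rev 4: restated Assembly (stmt-RiemannHypothesis-2872) — route-choice step 2/2 after refuted-substantive stmt-RiemannHypothesis-2994 (InverseTuranLattice; chirped theta bows, refuter-rattack-2994): NEXT LINE = cluster (planner-rchoice-RiemannHypothesis-Fences-stmt--8f57a55c-0)
- 2026-08-16T03:31:08Z · rev 4: dropped stmt-RiemannHypothesis-2864, stmt-RiemannHypothesis-2865, stmt-RiemannHypothesis-2869 — route-choice step 2/2 after refuted-substantive stmt-RiemannHypothesis-2994 (InverseTuranLattice; chirped theta bows, refuter-rattack-2994): NEXT LINE = cluster (planner-rchoice-RiemannHypothesis-Fences-stmt--8f57a55c-0)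
- 2026-08-17T05:07:39Z · LINT AUTOFIX route.multi-assembly: kept Assembly, dropped Assembly2 (gate:hygiene)
- 2026-08-26T13:40:03Z · DORMANT — reconciler: no traction for 6.7 d (last activity item-proof-filed at 2026-08-19T20:26:07Z); parked, not closed — `ledger route dormant route-RiemannHypothesis-F (operator:999:3211487)

sub-problem: RiemannHypothesis · status: dormant · opened planner-plancard-RiemannHypothesis-RiemannHyp-7517ed09-0 2026-08-15T11:09:09Z · rev 9 · ledger route-RiemannHypothesis-Fences
GENERATED by the gate from the ledger (D-0016/17). Provers cite these decls: `theorem foo : Summit.RiemannHypothesis.RiemannHypothesis.Theses.Fences.<Decl> := …` in Summits/RiemannHypothesis/RiemannHypothesis/Theorems/<Name>.lean.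
-/

namespace Summit.RiemannHypothesis.RiemannHypothesis.Theses.Fences

open scoped BigOperators Topology Manifold Classical MeasureTheory ProbabilityTheory Matrix InnerProductSpace ComplexConjugate ContinuousMap
open Filter Set Function TopologicalSpace MeasureTheory

attribute [summit_statement] _root_.Summit.RiemannHypothesis

open Summit

/-- item stmt-RiemannHypothesis-14529 · crux · rank 2 · open · by planner
why it might fail: A budget-B configuration might cancel the distinguished term across a one-sided gap of K log B/A (budgeted superoscillation by far or right-lying signed nodes); Lemma 11's Jensen-at-iA proof has no two-sided analogue — off the axis far nodes are amplified.
sources: MaynardPratt2024, arXiv:2206.11729, Montgomery1994, zbl:0991.42001, doi:10.1088/0305-4470/37/50/009, Literature.Analysis.Complex.MaynardPratt2024_lemma11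
[crux] Budgeted two-sided power-sum inverse theorem (first neighbours): ∃ C, K > 0, B₀ such that for
every finite configuration (z_r, c_r) with a distinguished term (0,1), budget Σ|c_r|·max(1, e^{2A Re
z_r}) ≤ B (B ≥ B₀, A > 0), near-positivity |arg c_r| ≤ 1/10 whenever |z_r| ≤ K log B/A, and
sup_{t∈[A,2A]}|Σ c_r e^{t z_r}| ≤ B^{-C}, some node lies strictly above 0 within Im-distance K log
B/A at depth Re z ≥ −K log B/A and some node strictly below likewise. One-sided case = Maynard–Pratt
Lemma 11 (PROVED in tree: MaynardPratt2024_lemma11_holds); right-lying nodes allowed, charged e^{2A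
Re z}; flank scale K log B/A (not K/A) because Gaussian combs of width √(C log B)/A are invisible;
dust flankers (tiny |c_r|) deliberately allowed (the ζ-application has |c| ≥ 1/2 in the box).
Replaces the REFUTED lattice conclusion of InverseTuranLattice (stmt-2994: theta bows). [deps: none]
[difficulty: XL] -/
@[route_item "route-RiemannHypothesis-Fences"]
def TwoSidedPowerSum : Prop :=
  ∃ C : ℝ, 0 < C ∧ ∃ K : ℝ, 0 < K ∧ ∃ B₀ : ℝ, ∀ (ι : Type) (s : Finset ι) (z c : ι → ℂ) (A B : ℝ), 0 < A → B₀ ≤ B → (∃ i ∈ s, z i = 0 ∧ c i = 1) → ∑ r ∈ s, ‖c r‖ * max 1 (Real.exp (2 * A * (z r).re)) ≤ B → (∀ r ∈ s, ‖z r‖ ≤ K * Real.log B / A → |(c r).arg| ≤ 1 / 10) → (∀ t ∈ Set.Icc A (2 * A), ‖∑ r ∈ s, c r * Complex.exp ((t : ℂ) * z r)‖ ≤ B ^ (-C)) → (∃ r ∈ s, 0 < (z r).im ∧ (z r).im ≤ K * Real.log B / A ∧ -(K * Real.log B / A) ≤ (z r).re) ∧ (∃ r ∈ s, (z r).im < 0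 ∧ -(K * Real.log B / A) ≤ (z r).im ∧ -(K * Real.log B / A) ≤ (z r).re)

/-- item stmt-RiemannHypothesis-14530 · crux · rank 3 · open · by planner
why it might fail: Needs TwoSidedPowerSum exactly as typed (positivity zone AND flank box K log B/A; a (log B)^2/A zone as in Lemma 11 reaches absolute size >> 1 once budgets carry e^{2A d_j}); window, slack and T-uniformity must survive explicit-formula bookkeeping with multiplicities.
sources: MaynardPratt2024, arXiv:2206.11729, Titchmarsh1986, Literature.NumberTheory.LFunctions.MaynardPratt2024_prop16
[crux] Prime-sum cancellation forces clusters: ∃ c > 0 and an admissible bump w (C^∞, ≥ 0, supp ⊆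
[1/2,2], w(1)=1) such that ∀ η > 0, T ≥ T₀(η): IF |Σ Λ(n) w(n/U) n^{-s}| ≤ U^{1/2−Re s}(log T)^3 for
1/2+η ≤ Re s ≤ 1, Im s ∈ [T,2T], log U ∈ [log T/loglog T, 2 log T/loglog T]
(ShortPrimeSumCancellation's conclusion at (w,η,T), verbatim) THEN every zero ρ₀ with Re ρ₀ ≥
1/2+2η, Im ρ₀ ∈ [T+1,2T−1] which is near-apex (all zeros within (log T)² vertically have Re ≤ Re ρ₀
+ (loglog T)²/log T) has ≥ c·loglog T distinct zeros with Re ≥ 1/2+η within vertical distance 1.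
Intended proof: explicit formula at ρ_j over all zeros of the (log T)²-window (error T^{-0.6} via
w₀-type Mellin decay), budget B_j ≤ (log T)^5 e^{2A d_j}, TwoSidedPowerSum at each step, recursion
d_{j+1} ≤ (1+2KC)d_j + 5K loglog T/A ⇒ ≥ loglog T/(2 log(1+2KC)) ordinate-increasing steps inside a
window < 1/4. RH-vacuous (no zeros right of 1/2+2η) but meant to be proved unconditionally. [deps:
TwoSidedPowerSum] [difficulty: XL] -/
@[route_item "route-RiemannHypothesis-Fences", crux]
def ClusterForcing : Prop :=
  ∃ c : ℝ, 0 < c ∧ ∃ w : ℝ → ℝ, ContDiff ℝ (⊤ : ℕ∞) w ∧ (∀ x, 0 ≤ w x) ∧ Function.support w ⊆ Set.Icc (1 / 2) 2 ∧ w 1 = 1 ∧ ∀ η : ℝ, 0 < η → ∃ T₀ : ℝ, ∀ T : ℝ, T₀ ≤ T → (∀ s : ℂ, 1 / 2 + η ≤ s.re → s.re ≤ 1 → T ≤ s.im → s.im ≤ 2 * T → ∀ U : ℝ, 1 < U → Real.log T / Real.log (Real.log T) ≤ Real.log U → Real.log U ≤ 2 * Real.log T / Real.log (Real.log T) → ‖∑'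 n : ℕ, ((ArithmeticFunction.vonMangoldt n : ℝ) : ℂ) * ((w ((n : ℝ) / U) : ℝ) : ℂ) * (n : ℂ) ^ (-s)‖ ≤ U ^ (1 / 2 - s.re) * Real.log T ^ 3) → ∀ ρ₀ : ℂ, riemannZeta ρ₀ = 0 → 1 / 2 + 2 * η ≤ ρ₀.re → T + 1 ≤ ρ₀.im → ρ₀.im ≤ 2 * T - 1 → (∀ ρ : ℂ, riemannZeta ρ = 0 → |ρ.im - ρ₀.im| ≤ Real.log T ^ 2 → ρ.re ≤ ρ₀.re + Real.log (Real.log T) ^ 2 / Real.log T) → ∃ S : Finset ℂ, c * Real.log (Real.log T) ≤ (S.card : ℝ) ∧ ∀ ρ ∈ S, riemannZeta ρ = 0 ∧ 1 / 2 + η ≤ ρ.re ∧ |ρ.im - ρ₀.im| ≤ 1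

/-- item stmt-RiemannHypothesis-17850 · crux · rank 3 · open · by planner
why it might fail: RH-vacuous; unconditionally its only supplier is a budgeted two-sided power-sum inverse theorem (TwoSidedPowerSum or a zone/flank-decoupled variant): budgeted superoscillation across a one-sided gap of K log B/A (theta bows with the nodes above the apex deleted) would leave it with no mechanism.
sources: MaynardPratt2024 = arXiv:2206.11729: Lemma 11 p. 8, Remark 13 pp. 8–9, Prop. 16 p. 10, lean: Literature.Analysis.Complex.MaynardPratt2024_lemma11_holds; Literature.NumberTheory.LFunctions.MaynardPratt.smoothedVonMangoldt_w0_eq_explicit, route items stmt-RiemannHypothesis-14529 (TwoSidedPowerSum), stmt-RiemannHypothesis-2994 (InverseTuranLattice, REFUTED: theta bows), Montgomery1994 ch. 5; zbl:0991.42001 (Nazarov)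
[crux] ZERO-CHAIN STEP (child 1 of the BC2-redirect split of ClusterForcing; crux-strategist r1): ∃
a, b > 0 and an admissible bump w (C^∞, ≥ 0, supp ⊆ [1/2,2], w(1) = 1) such that for every η > 0
there are a depth allowance 0 < D ≤ η and T₀ with: for T ≥ T₀, IF the short prime sums Σ Λ(n) w(n/U)
n^{-s} have square-root cancellation |·| ≤ U^{1/2−Re s}(log T)^3 on 1/2+η ≤ Re s ≤ 1, Im s ∈ [T,2T],
log U ∈ [log T/loglog T, 2 log T/loglog T] (ShortPrimeSumCancellation's conclusion at (w,η,T),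
verbatim = ClusterForcing's hypothesis), THEN below every near-apex zero ρ₀ (Re ρ₀ ≥ 1/2+2η, Im ρ₀ ∈
[T+1,2T−1], all zeros within (log T)² vertically have Re ≤ Re ρ₀ + (loglog T)²/log T) EVERY zero ρ
at depth d (0 ≤ d ≤ D, Re ρ ≥ Re ρ₀ − d) within vertical distance 1/4 of ρ₀ has a SUCCESSOR zero ρ'
strictly above it: Im ρ < Im ρ' ≤ Im ρ + g and Re ρ' ≥ Re ρ − g with g = a·d + b·(loglog T)²/log T.
This is ONE application of a budgeted two-sided power-sum inverse theorem to the local power sum at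
ρ (explicit formula at ρ over the zeros within (log T)²/2, budget B = C(log T)^5 e^{2Ad}, A = log
T/loglog T, flank K log B/A = 2Kd + O(K (loglog T)²/log T)): suppliers TwoSidedPowerSum
(stmt-RiemannHypothe -/
@[route_item "route-RiemannHypothesis-Fences"]
def ZeroChainStep : Prop :=
  ∃ a : ℝ, 0 < a ∧ ∃ b : ℝ, 0 < b ∧ ∃ w : ℝ → ℝ, ContDiff ℝ (⊤ : ℕ∞) w ∧ (∀ x, 0 ≤ w x) ∧ Function.support w ⊆ Set.Icc (1 / 2) 2 ∧ w 1 = 1 ∧ ∀ η : ℝ, 0 < η → ∃ D : ℝ, 0 < D ∧ D ≤ η ∧ ∃ T₀ : ℝ, ∀ T : ℝ, T₀ ≤ T → (∀ s : ℂ, 1 / 2 + η ≤ s.re → s.re ≤ 1 → T ≤ s.im → s.im ≤ 2 * T → ∀ U : ℝ, 1 < U → Real.log T / Real.log (Real.log T) ≤ Real.log U → Real.log U ≤ 2 * Real.log T / Real.log (Real.log T) → ‖∑' n : ℕ, ((ArithmeticFunction.vonMangoldt n : ℝ) : ℂ) * ((w ((n : ℝ) / U) : ℝ) : ℂ) * (n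 : ℂ) ^ (-s)‖ ≤ U ^ (1 / 2 - s.re) * Real.log T ^ 3) → ∀ ρ₀ : ℂ, riemannZeta ρ₀ = 0 → 1 / 2 + 2 * η ≤ ρ₀.re → T + 1 ≤ ρ₀.im → ρ₀.im ≤ 2 * T - 1 → (∀ ρ : ℂ, riemannZeta ρ = 0 → |ρ.im - ρ₀.im| ≤ Real.log T ^ 2 → ρ.re ≤ ρ₀.re + Real.log (Real.log T) ^ 2 / Real.log T) → ∀ ρ : ℂ, riemannZeta ρ = 0 → ∀ d : ℝ, 0 ≤ d → d ≤ D → ρ₀.re - d ≤ ρ.re → |ρ.im - ρ₀.im| ≤ 1 / 4 → ∃ ρ' : ℂ, riemannZeta ρ' = 0 ∧ ρ.im < ρ'.im ∧ ρ'.im ≤ ρ.im + (a * d + b * Real.log (Real.log T) ^ 2 / Real.log T) ∧ ρ.re - (a * d + b * Real.log (Real.log T) ^ 2 / Real.log T) ≤ ρ'.re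

/-- item stmt-RiemannHypothesis-14531 · crux · rank 4 · open · by planner
why it might fail: RH-vacuous and at least Lindelöf-hard (implies Backlund's o(log T) condition, equivalent to LH); no tool bounds off-line zeros in a unit window below O(log T); fails for Davenport–Heilbronn-type series with off-line clusters.
sources: Titchmarsh1986, zbl:1228.11134, doi:10.1090/proc/14974, Literature.Barriers.RiemannHypothesis.Titchmarsh1986_thm13_5
[crux] Sub-loglog clustering of off-line zeros (replaces NoFences): ∀ η > 0, b > 0, T ≥ T₀(η,b), t ∈
[T,2T]: every finite set of zeros of ζ with Re ≥ 1/2+η and |Im − t| ≤ 1 has ≤ b·loglog T elements.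
Unconditionally O(log T) (Titchmarsh Thm 9.2); 'o(log T) for every η' ⟺ Lindelöf hypothesis
(Backlund 1918–19, Titchmarsh Thm 13.5 = tree Titchmarsh1986_thm13_5 / BacklundZeroCondition); RH
gives 0. So RH ⇒ this ⇒ LH. No tool; RH-vacuous. [deps: none] [difficulty: open-problem] -/
@[route_item "route-RiemannHypothesis-Fences", crux]
def SubLoglogClustering : Prop :=
  ∀ η : ℝ, 0 < η → ∀ b : ℝ, 0 < b → ∃ T₀ : ℝ, ∀ T : ℝ, T₀ ≤ T → ∀ t : ℝ, T ≤ t → t ≤ 2 * T → ∀ S : Finset ℂ, (∀ ρ ∈ S, riemannZeta ρ = 0 ∧ 1 / 2 + η ≤ ρ.re ∧ |ρ.im - t| ≤ 1) → (S.card : ℝ) ≤ b * Real.log (Real.log T)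

/-- item stmt-RiemannHypothesis-2866 · crux · rank 4 · open · by planner
why it might fail: RH-strength: square-root cancellation of Σ Λ(n)w(n/U)n^{-s} at U = T^{1/loglog T}; Vinogradov–Korobov saves only exp(−c log U/(loglog T)²); with LONG sums it would be RH itself (Landau/Turán; Gonek–Graham–Lee 2020); now feeds ClusterForcing's hypothesis.
sources: Ivic1985, MontgomeryVaughan2007, MossinghoffTrudgianYang2024, MaynardPratt2024, doi:10.1090/proc/14974
[crux] [new; the prime-sum face of the route] for every smooth bump w ≥ 0 on [1/2,2], every η > 0
and T ≥ T₀(w,η): |Σ_n Λ(n) w(n/U) n^{-s}| ≤ U^{1/2−Re s} (log T)^3 for all s with 1/2+η ≤ Re s ≤ 1,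
Im s ∈ [T,2T] and all U with log U ∈ [log T/loglog T, 2 log T/loglog T]. RH gives it with (log
T)^{1+o(1)} by the explicit formula (|W(z)| ≪_w min(1,|Im z|^{-2}), zeros of density log T); it
kills the DETECTED alternative of FenceDichotomy since U^{1/2−β}(log T)^3 ≤ exp(−η log T/loglog
T)(log T)^3 < (log T)^{-C}. [difficulty: open-problem] -/
@[route_item "route-RiemannHypothesis-Fences", crux]
def ShortPrimeSumCancellation : Prop :=
  ∀ w : ℝ → ℝ, ContDiff ℝ (⊤ : ℕ∞) w → (∀ x, 0 ≤ w x) → Function.support w ⊆ Set.Icc (1 / 2) 2 → ∀ η : ℝ, 0 < η → ∃ T₀ : ℝ, ∀ T : ℝ, T₀ ≤ T → ∀ s : ℂ, 1 / 2 + η ≤ s.re → s.re ≤ 1 → T ≤ s.im → s.im ≤ 2 * T → ∀ U : ℝ, 1 < U → Real.log T / Real.log (Real.log T) ≤ Real.log U → Real.log U ≤ 2 * Real.log T / Real.log (Real.log T) → ‖∑' n : ℕ, ((ArithmeticFunction.vonMangoldt n : ℝ) : ℂ) * ((w ((n : ℝ) / U) : ℝ) : ℂ) * (n : ℂ) ^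 (-s)‖ ≤ U ^ (1 / 2 - s.re) * Real.log T ^ 3

/-- item stmt-RiemannHypothesis-2867 · crux · rank 5 · open · by planner
why it might fail: Needs ℤ-specific input, none known: on RH the Beurling system of Broucke–Debruyne–Révész 2023 §5 has exactly ONE zero in Re s > 1/2: finite ≠ empty; Bohr–Jessen recurrence only σ > 1, Bagchi's is RH-equivalent.
sources: BrouckeDebruyneRevesz2023, DiamondMontgomeryVorhauer2006, Bagchi1987, Bombieri2000Weil, Titchmarsh1986, Literature.Barriers.RiemannHypothesis.BrouckeDebruyneRevesz2023_thm13
[crux] [new; cf. card zero-or-infinity-offline, which has only the total version FIN ⇒ RH] for every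
1/2 < σ₀ < 1: if the set of zeros of ζ with σ₀ ≤ Re s < 1 is finite, it is empty. Weaker than RH,
stronger than Bombieri's 'finitely many off-line zeros ⇒ none'; it converts the
finitely-many-exceptions output of X1–X3 into quasi-RH at every level. [difficulty: open-problem] -/
@[route_item "route-RiemannHypothesis-Fences", crux]
def LevelwiseZeroOrInfinity : Prop :=
  ∀ σ₀ : ℝ, 1 / 2 < σ₀ → σ₀ < 1 → Set.Finite {s : ℂ | riemannZeta s = 0 ∧ σ₀ ≤ s.re ∧ s.re < 1} → ∀ s : ℂ, riemannZeta s = 0 → σ₀ ≤ s.re → s.re < 1 → False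

/-- item stmt-RiemannHypothesis-14532 · support · rank 9 · open · by planner
sources: MaynardPratt2024, Titchmarsh1986
[support] [glue] ClusterForcing → SubLoglogClustering → ShortPrimeSumCancellation → for every σ₀ >
1/2 the zeros with σ₀ ≤ Re s < 1 form a finite set. Proof: η := (σ₀−1/2)/2; c, w from
ClusterForcing; T₀ := max of the three thresholds (X3 at (w,η), X1 at η, X2 at (η, c/2)) and an
absolute constant; given a zero ρ with Re ρ ≥ σ₀ at height h ≥ 1.5T₀ set T := 2h/3, κ := (loglog
T)²/(log T)³ and let ρ₀ maximise Re ρ' − κ|Im ρ' − h| over the finite set of zeros with Re ≥ σ₀, |Im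
− h| ≤ T/4 (zetaZeroBox_finite): then |Im ρ₀ − h| ≤ (log T)³/(2 (loglog T)²) so Im ρ₀ ∈ [T+1, 2T−1],
Re ρ₀ ≥ 1/2+2η, and ρ₀ is near-apex with slack κ(log T)² = (loglog T)²/log T; X3 supplies X1's
hypothesis, X1 gives ≥ c loglog T zeros in ρ₀'s unit window right of 1/2+η, X2 at t = Im ρ₀ allows ≤
(c/2) loglog T — contradiction. Negative ordinates by riemannZeta_conj_eq_zero; the rest is a
compact box. [deps: ClusterForcing, SubLoglogClustering, ShortPrimeSumCancellation] [difficulty: M,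
provable-now] -/
@[route_item "route-RiemannHypothesis-Fences", crux]
def FiniteExceptionsFromClusters : Prop :=
  ClusterForcing → SubLoglogClustering → ShortPrimeSumCancellation → ∀ σ₀ : ℝ, 1 / 2 < σ₀ → Set.Finite {s : ℂ | riemannZeta s = 0 ∧ σ₀ ≤ s.re ∧ s.re < 1}

/-- item stmt-RiemannHypothesis-17851 · support · rank 9 · open · by planner
sources: MaynardPratt2024 = arXiv:2206.11729, Prop. 16 proof p. 10, Lemma 43 p. 25, lean: MaynardPratt.smoothedVonMangoldt_w0_eq_explicit, MaynardPratt.sum_excluded_zeros_le, exists_norm_W0_le_exp_neg_sqrt, W0_zero, norm_W0_sub_log_two_le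
[support] LOCAL ZERO POWER SUM (top-layer supplier of ZeroChainStep; crux-strategist r1; PROVABLE
NOW from the tree's Maynard–Pratt toolkit, size M–L): there is an admissible bump w (witness:
MaynardPratt.w0, tree w0_admissible) and C > 0, T₁ such that for T ≥ T₁ and every zero s₀ of ζ with
Re s₀ ≥ 1/2, Im s₀ ∈ [T,2T] there are a finite set S ∋ s₀ of zeros, all with |Im ρ − Im s₀| ≤ (log
T)²/2, and coefficients c with c(s₀) = 1, Σ_S |c ρ| ≤ C (log T)³, |arg c ρ| ≤ 1/10 whenever |ρ − s₀|
≤ 1/C, and for every u ∈ [log T/loglog T, 2 log T/loglog T]: |Σ_{ρ∈S} c ρ e^{u(ρ−s₀)}| ≤ C (|Σ_n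
Λ(n) w(n/e^u) n^{-s₀}| + (e^u)^{1/2−Re s₀} + T^{-1/4}). Proof (the Prop. 16 proof WITHOUT
half-isolation, all zeros of the window kept): S := nontrivial zeros with |Im ρ − Im s₀| ≤ (log
T)²/2 (finite: riemannZetaNontrivialZeros_finite_inter_ball), c ρ := (m(ρ)/m(s₀))·W₀(ρ−s₀)/W₀(0)
with W₀ = mellin w₀, W₀(0) = log 2 (HalfIsolatedZeroMellin.W0_zero); identity from
MaynardPratt.smoothedVonMangoldt_w0_eq_explicit at ρ₀ = s₀, U = e^u ≥ 3: Σ_S m(ρ)U^{ρ−s₀}W₀(ρ−s₀) =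
U^{1−s₀}W₀(1−s₀) − Σ_{far} − Σ_{trivial} − S_U(s₀); pole ≤ 2C_b U^{1/2}/(1+Im²) ≤ T^{-1}
(norm_pole_term_le; U^{1/2} ≤ T^{1/loglog T}); trivial z -/
@[route_item "route-RiemannHypothesis-Fences"]
def LocalZeroPowerSum : Prop :=
  ∃ w : ℝ → ℝ, ContDiff ℝ (⊤ : ℕ∞) w ∧ (∀ x, 0 ≤ w x) ∧ Function.support w ⊆ Set.Icc (1 / 2) 2 ∧ w 1 = 1 ∧ ∃ C : ℝ, 0 < C ∧ ∃ T₁ : ℝ, ∀ T : ℝ, T₁ ≤ T → ∀ s₀ : ℂ, riemannZeta s₀ = 0 → 1 / 2 ≤ s₀.re → T ≤ s₀.im → s₀.im ≤ 2 * T → ∃ S : Finset ℂ, ∃ c : ℂ → ℂ, s₀ ∈ S ∧ c s₀ = 1 ∧ (∀ ρ ∈ S, riemannZeta ρ = 0 ∧ |ρ.im - s₀.im| ≤ Real.log T ^ 2 / 2) ∧ ∑ ρ ∈ S, ‖c ρ‖ ≤ C * Real.log T ^ 3 ∧ (∀ ρ ∈ S, ‖ρ - s₀‖ ≤ 1 /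 C → |(c ρ).arg| ≤ 1 / 10) ∧ ∀ u : ℝ, Real.log T / Real.log (Real.log T) ≤ u → u ≤ 2 * Real.log T / Real.log (Real.log T) → ‖∑ ρ ∈ S, c ρ * Complex.exp ((u : ℂ) * (ρ - s₀))‖ ≤ C * (‖∑' n : ℕ, ((ArithmeticFunction.vonMangoldt n : ℝ) : ℂ) * ((w ((n : ℝ) / Real.exp u) : ℝ) : ℂ) * (n : ℂ) ^ (-s₀)‖ + Real.exp u ^ (1 / 2 - s₀.re) + T ^ (-(1 / 4 : ℝ)))

/-- item stmt-RiemannHypothesis-17856 · support · rank 9 · closed · proved by Summit.RiemannHypothesis.RiemannHypothesis.Theorems.FencesChainCount.chainCount_proof @ 7a0df3985fa1 (prover) · by planner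
sources: MaynardPratt2024 = arXiv:2206.11729 §8 p. 20, route header NUMBERS (chain length bound)
[support] CHAIN COUNT (child 2 of the BC2-redirect split of ClusterForcing; crux-strategist r1;
PROVABLE NOW, size M): ZeroChainStep → ClusterForcing. Proof: take a, b, w from the step and put c
:= 1/(2 log(1+a)) (> 0). Given η > 0 take 0 < D ≤ η and T₀ from the step and enlarge T₀ depending on
(η, a, b, D). For T ≥ T₀ assume the prime-sum hypothesis (it is passed to the step verbatim) and let
ρ₀ be a near-apex zero as in ClusterForcing. Put β := b (loglog T)²/log T, d₀ := 0, d_{j+1} := (1+a)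
d_j + β (so d_j = β((1+a)^j − 1)/a, increasing) and D' := min(D, 1/4). INDUCTION on j while d_j ≤
D': there are zeros ρ₀, ρ₁, …, ρ_j with strictly increasing ordinates, Im ρ₀ ≤ Im ρ_i ≤ Im ρ₀ + d_i
and Re ρ_i ≥ Re ρ₀ − d_i (apply the step at ρ = ρ_j with d = d_j ≤ D' ≤ D, |Im ρ_j − Im ρ₀| ≤ d_j ≤
1/4: the successor ρ_{j+1} has Im ρ_j < Im ρ_{j+1} ≤ Im ρ_j + (a d_j + β) ≤ Im ρ₀ + d_{j+1} and Re
ρ_{j+1} ≥ Re ρ_j − (a d_j + β) ≥ Re ρ₀ − d_{j+1}). COUNT: with k := ⌊log(1 + aD'/β)/log(1+a)⌋₊ one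
has (1+a)^k ≤ 1 + aD'/β, i.e. d_k ≤ D', and k + 1 ≥ log(1 + aD'/β)/log(1+a) ≥ (log log T − 2 log log
log T + log(aD'/b))/log(1+a) ≥ log log T/(2 log(1+a)) = c·loglog T once loglog T ≥ 4 logloglog T − 2
log( -/
@[route_item "route-RiemannHypothesis-Fences"]
def ChainCount : Prop :=
  ZeroChainStep → ClusterForcing

-- `ChainCount` holds: proved by `Summit.RiemannHypothesis.RiemannHypothesis.Theorems.FencesChainCount.chainCount_proof` @ 7a0df3985fa1 (its module imports this route file, so no `_holds` link can be stated here).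

/-- item stmt-RiemannHypothesis-2871 · support · rank 9 · open · by planner
sources: MaynardPratt2024, Montgomery1994
[support] [card I0, the sharp-constant problem, typed at exponent 1] there is c > 0 such that for
all R, all real θ₁..θ_R with some θ_i = 0 and all A > 0: sup_{t∈[A,2A]} |Σ_r e^{i t θ_r}| ≥ c/R.
Known: Maynard–Pratt Lemma 7 gives (B₀R)^{-99}; Bourgain's design (q²−q with q = 2+2cos(2πt/3A):
coefficients 1,3,4,3,1, sup 1/4, R = 12) and its powers give R^{-0.558}, so the true exponent κ* ∈
[0.558, 99]; the Jensen/harmonic-measure argument optimised (evaluation at i√2·A, harmonic measure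
0.108 of [A,2A]) should give κ* ≲ 8.3. Refutable by a better design (kit: search symmetric
nonnegative-integer cosine polynomials F(2+2cos u) small on q ∈ [0,1] relative to F(4)), provable by
sharpening Lemma 11. Not on the chain to X (any finite exponent serves X1) — it calibrates the
detection threshold C. [difficulty: M] -/
@[route_item "route-RiemannHypothesis-Fences"]
def PowerSumExponentOne : Prop :=
  ∃ c : ℝ, 0 < c ∧ ∀ (R : ℕ) (θ : Fin R → ℝ), (∃ i, θ i = 0) → ∀ A : ℝ, 0 < A → ∃ t ∈ Set.Icc A (2 * A), c / (R : ℝ) ≤ ‖∑ i, Complex.exp (Complex.I * (t : ℂ) * (θ i : ℂ))‖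

/-- item stmt-RiemannHypothesis-17860 · support · rank 10 · open · by planner
sources: MaynardPratt2024 = arXiv:2206.11729 Prop. 16 proof p. 10, lean: Literature.NumberTheory.LFunctions.MaynardPratt2024_prop16_of_lemma11 (the one-sided instance)
[support] STEP FROM INVERSE (top-layer glue of the BC2 redirect; crux-strategist r1; PROVABLE NOW,
size M–L, pure bookkeeping of budgets): TwoSidedPowerSum → LocalZeroPowerSum → ZeroChainStep. Proof:
let C, K, B₀ be the constants of TwoSidedPowerSum and w, C_L, T₁ those of LocalZeroPowerSum; take a
:= 2K, b := 6K and this w. Given η > 0 put D := min(η, η/(8C), 1/(8 K C_L)) and T₀ := max(T₁, T_*(η,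
C, K, C_L)) large. Fix T ≥ T₀, L := log T, ℓ := log L, A := L/ℓ, assume the prime-sum hypothesis
HYP(w, η, T), let ρ₀ be near-apex (Re ρ₀ ≥ 1/2 + 2η, Im ρ₀ ∈ [T+1, 2T−1], every zero within L²
vertically has Re ≤ Re ρ₀ + ℓ²/L) and let ρ be a zero with Re ρ ≥ Re ρ₀ − d (0 ≤ d ≤ D) and |Im ρ −
Im ρ₀| ≤ 1/4. LocalZeroPowerSum at s₀ := ρ (Re ρ ≥ 1/2 + η ≥ 1/2, T ≤ Im ρ ≤ 2T) gives S ∋ ρ and c.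
Apply TwoSidedPowerSum with ι := ℂ, s := S, z := (· − ρ), c, A, B := C_L L^5 e^{2Ad} (≥ B₀ for T
large): (distinguished) z ρ = 0, c ρ = 1; (budget) each ρ'' ∈ S is a zero with |Im ρ'' − Im ρ| ≤
L²/2, hence |Im ρ'' − Im ρ₀| ≤ L², so by near-apex Re(ρ'' − ρ) ≤ d + ℓ²/L and max(1, e^{2A Re z}) ≤
e^{2Ad} e^{2ℓ} = L² e^{2Ad}; with Σ|c| ≤ C_L L³ the budget is ≤ B; (near-positivity) K log B/A =
K(log C_L + 5ℓ)/ -/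
@[route_item "route-RiemannHypothesis-Fences"]
def StepFromInverse : Prop :=
  TwoSidedPowerSum → LocalZeroPowerSum → ZeroChainStep

-- earlier Assembly (stmt-RiemannHypothesis-2872, replaced 2026-08-16T03:31:08Z -> stmt-RiemannHypothesis-14528): retired by None — FenceDichotomy → NoFences → ShortPrimeSumCancellation → LevelwiseZeroOrInfinity → Summit.RiemannHypothesis
/-- item stmt-RiemannHypothesis-14528 · assembly · rank 1 · open · by planner
sources: MaynardPratt2024, Titchmarsh1986
[assembly] rev 4: ClusterForcing → SubLoglogClustering → ShortPrimeSumCancellation →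
LevelwiseZeroOrInfinity → Summit.RiemannHypothesis (the clusters chain; follows from the deciding
theorem `closes` once FiniteExceptionsFromClusters is proved). Replaces the rev-2 fence chain
FenceDichotomy → NoFences → ShortPrimeSumCancellation → LevelwiseZeroOrInfinity → RH. -/
@[route_item "route-RiemannHypothesis-Fences"]
def Assembly : Prop :=
  ClusterForcing → SubLoglogClustering → ShortPrimeSumCancellation → LevelwiseZeroOrInfinity → Summit.RiemannHypothesis

-- records of items no longer active in this route (dropped / restated):
-- earlier Assembly2 (stmt-RiemannHypothesis-17861, dropped 2026-08-17T05:07:39Z): moot by None — TwoSidedPowerSum → LocalZeroPowerSum → ClusterForcing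

/-! D-0027 §2.1 — DECIDING THEOREM (planner-authored via `route open/edit --closes-file`; by planner-rchoice-RiemannHypothesis-Fences-stmt--8f57a55c-0 2026-08-16T03:31:08Z):
its hypotheses are this route's items and its conclusion the sub-problem Statement (glue_lint), and it elaborates with this file. -/

@[closes "route-RiemannHypothesis-Fences"] theorem closes (h₁ : ClusterForcing) (h₂ : SubLoglogClustering) (h₃ : ShortPrimeSumCancellation)
    (h₄ : LevelwiseZeroOrInfinity) (h₅ : FiniteExceptionsFromClusters) : _root_.Summit.RiemannHypothesis := by
  -- (1) X1–X3 leave finitely many zeros right of every abscissa σ₀ > 1/2 (support item `FiniteExceptionsFromClusters`).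
  have hfin : ∀ σ₀ : ℝ, 1 / 2 < σ₀ →
      Set.Finite {s : ℂ | riemannZeta s = 0 ∧ σ₀ ≤ s.re ∧ s.re < 1} := h₅ h₁ h₂ h₃
  -- (2) X4 empties every level: no zero with 1/2 < re s < 1.
  have hq : ∀ s : ℂ, riemannZeta s = 0 → 1 / 2 < s.re → s.re < 1 → False :=
    fun s hs h0 h1 => h₄ s.re h0 h1 (hfin s.re h0) s hs le_rfl h1
  -- (3) hence no zero with re s > 1/2 at all (Mathlib: ζ ≠ 0 on re s ≥ 1).
  have hright : ∀ s : ℂ, riemannZeta s = 0 → 1 / 2 < s.re → False := by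
    intro s hs h0
    by_cases h1 : s.re < 1
    · exact hq s hs h0 h1
    · exact riemannZeta_ne_zero_of_one_le_re (not_lt.1 h1) hs
  -- (4) RH: a non-trivial zero with re s < 1/2 is reflected by the functional equation to t = 1 - s.
  intro s hs hnt _hs1
  rcases lt_trichotomy (s.re) (1 / 2) with hlt | heq | hgt
  · exfalso
    have hs0 : s ≠ 0 := by
      rintro rfl
      rw [riemannZeta_zero] at hs
      norm_num at hs
    set t : ℂ := 1 - s with ht
    have hst : s = 1 - t := by simp [ht]
    have htre : 1 / 2 < t.re := by
      rw [ht, Complex.sub_re, Complex.one_re]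
      linarith
    have ht1 : t ≠ 1 := fun h1 => hs0 (by simp [hst, h1])
    have htn : ∀ n : ℕ, t ≠ -n := by
      intro n hn
      have := congrArg Complex.re hn
      simp at this
      linarith [n.cast_nonneg (α := ℝ)]
    have hfe := riemannZeta_one_sub htn ht1
    rw [← hst, hs] at hfe
    have hΓ : Complex.Gamma t ≠ 0 := Complex.Gamma_ne_zero_of_re_pos (by linarith)
    have hπ : (Real.pi : ℂ) ≠ 0 := by exact_mod_cast Real.pi_ne_zero
    have hpow : (2 * (Real.pi : ℂ)) ^ (-t) ≠ 0 := by
      rw [Ne, Complex.cpow_eq_zero_iff, not_and_or]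
      exact Or.inl (by simp [hπ])
    by_cases hζt : riemannZeta t = 0
    · exact hright t hζt htre
    · have hcos : Complex.cos (Real.pi * t / 2) = 0 := by
        have : 2 * (2 * (Real.pi : ℂ)) ^ (-t) * Complex.Gamma t * Complex.cos (Real.pi * t / 2) *
            riemannZeta t = 0 := hfe.symm
        simpa [hζt, hΓ, hpow] using this
      obtain ⟨k, hk⟩ := Complex.cos_eq_zero_iff.1 hcos
      have htk : t = 2 * k + 1 := by
        have := mul_right_cancel₀ hπ
          (by linear_combination 2 * hk : t * Real.pi = (2 * k + 1) * Real.pi)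
        simpa using this
      have hsk : s = -2 * k := by rw [hst, htk]; ring
      have hk0 : 0 ≤ k := by
        have h2 := congrArg Complex.re hsk
        simp at h2
        have hk' : (-1 : ℝ) < k := by linarith
        have hk'' : (-1 : ℤ) < k := by exact_mod_cast hk'
        omega
      have hk1 : k ≠ 0 := by
        rintro rfl
        exact hs0 (by simpa using hsk)
      obtain ⟨n, rfl⟩ : ∃ n : ℕ, k = n + 1 := ⟨(k - 1).toNat, by omega⟩
      exact hnt ⟨n, by rw [hsk]; push_cast; ring⟩
  · exact heq
  · exact (hright s hs hgt).elim

end Summit.RiemannHypothesis.RiemannHypothesis.Theses.Fences
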